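import Summits.Ventures.PercRepro.ProfileGapMonoThresholdBiColoop

/-!
# PercRepro — THE BI-COLOOP IDENTITY AT OFFSET `0` (THE ROWS): THE LOST SETS `U` ARE THE COMPLEMENTS OF THE
HEAVY RANK-`(q−1)` BI-COLOOP SETS (p5, gen 25; `proofs/P5-GM1.md` §25(i)(2); announced INBOX before sending)

At `t = q` the rank-`(q−1)` correction `Σ_{W₁} lostCorr` splits into the bi-coloop sets with `m' = q` (weight `q + 1`)
and those with `m' ≥ q + 1` (weight `1`); complementation `X ↦ E' ∖ X` maps the bi-coloop sets of rank `q` and co-rank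
`q − 1` (the lost sets `U`) bijectively onto the bi-coloop sets of rank `q − 1` and co-rank `q`.  Hence
`q · #U − Σ_{W₁} = −#U − #{bi-coloop (q−1, ≥ q+1)}` and the identity reads
`Δ_z = G − #U − q · #V − #{bi-coloop (q−1, ≥ q+1)} + Σ_{W₂}`: at the rows every bi-coloop set of rank `q − 1` or `q`
costs, only those of rank `q − 2` pay (`biColoop_identity_row`).

* `biColoop_sdiff_mem`, `card_biColoop_row_compl`, `sum_lostCorr_row_split`, **`biColoop_identity_row`**.
-/

open scoped Matroid

namespace PercRepro.Cogirth

open Finset ThmH Skew Shadow Profile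

variable {α : Type} [DecidableEq α] {M : Matroid α} [M.Finite]

section BiColoopRow

variable {N : Matroid α} [N.Finite] {z : α} {q : ℕ}

/-- Complementation in `E' = E ∖ z` preserves the bi-coloop property and swaps rank and co-rank. -/
theorem biColoop_sdiff_mem {a b : ℕ} {X : Finset α} (hX : X ⊆ (gr N).erase z)
    (hr : rk N X = a) (hc : rk N ((gr N).erase z \ X) = b) (h1 : z ∉ clF N X)
    (h2 : z ∉ clF N ((gr N).erase z \ X)) :
    ((gr N).erase z \ X) ⊆ (gr N).erase z ∧ rk N ((gr N).erase z \ X) = b ∧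
      rk N ((gr N).erase z \ ((gr N).erase z \ X)) = a ∧ z ∉ clF N ((gr N).erase z \ X) ∧
      z ∉ clF N ((gr N).erase z \ ((gr N).erase z \ X)) := by
  have hXX : (gr N).erase z \ ((gr N).erase z \ X) = X := Finset.sdiff_sdiff_eq_self hX
  refine ⟨sdiff_subset, hc, ?_, h2, ?_⟩
  · rw [hXX]; exact hr
  · rw [hXX]; exact h1

/-- **Complementation**: the bi-coloop sets of rank `q` and co-rank `q − 1` are in bijection with the bi-coloop sets of
rank `q − 1` and co-rank `q`. -/
theorem card_biColoop_row_compl (hzI : N.Indep {z}) :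
    ((Rq N q).filter (fun S => z ∉ S ∧ (z ∉ clF N S ∧ z ∉ clF N ((gr N).erase z \ S)) ∧
        rk N ((gr N).erase z \ S) = q - 1)).card =
      ((Rq N (q - 1)).filter (fun B => z ∉ B ∧ (z ∉ clF N B ∧ z ∉ clF N ((gr N).erase z \ B)) ∧
        rk N ((gr N).erase z \ B) = q)).card := by
  have _hz : z ∈ gr N := mem_gr_of_indep hzI
  apply card_bij (fun S _ => (gr N).erase z \ S)
  · intro S hS
    rw [mem_filter, mem_Rq] at hS
    obtain ⟨⟨hSg, hSr⟩, hzS, ⟨h1, h2⟩, hc⟩ := hS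
    have hSE : S ⊆ (gr N).erase z := subset_erase.2 ⟨hSg, hzS⟩
    obtain ⟨hE, hr', hc', h1', h2'⟩ := biColoop_sdiff_mem hSE (rk_eq_of_eRk_eq_cq hSr) hc h1 h2
    rw [mem_filter, mem_Rq]
    refine ⟨⟨hE.trans (erase_subset _ _), eRk_eq_of_rk_eq_cq hr'⟩, ?_, ⟨h1', h2'⟩, hc'⟩
    exact fun h => (mem_erase.1 (hE h)).1 rfl
  · intro S₁ hS₁ S₂ hS₂ heq
    rw [mem_filter, mem_Rq] at hS₁ hS₂
    have hE₁ : S₁ ⊆ (gr N).erase z := subset_erase.2 ⟨hS₁.1.1, hS₁.2.1⟩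
    have hE₂ : S₂ ⊆ (gr N).erase z := subset_erase.2 ⟨hS₂.1.1, hS₂.2.1⟩
    rw [← Finset.sdiff_sdiff_eq_self hE₁, ← Finset.sdiff_sdiff_eq_self hE₂, heq]
  · intro B hB
    rw [mem_filter, mem_Rq] at hB
    obtain ⟨⟨hBg, hBr⟩, hzB, ⟨h1, h2⟩, hc⟩ := hB
    have hBE : B ⊆ (gr N).erase z := subset_erase.2 ⟨hBg, hzB⟩
    obtain ⟨hE, hr', hc', h1', h2'⟩ := biColoop_sdiff_mem hBE (rk_eq_of_eRk_eq_cq hBr) hc h1 h2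
    refine ⟨(gr N).erase z \ B, ?_, Finset.sdiff_sdiff_eq_self hBE⟩
    rw [mem_filter, mem_Rq]
    refine ⟨⟨hE.trans (erase_subset _ _), eRk_eq_of_rk_eq_cq hr'⟩, ?_, ⟨h1', h2'⟩, hc'⟩
    exact fun h => (mem_erase.1 (hE h)).1 rfl

/-- At `t = q` the rank-`(q−1)` correction is `(q+1)` per bi-coloop set of co-rank `q` and `1` per bi-coloop set of
co-rank `≥ q + 1` (`1 ≤ q`). -/
theorem sum_lostCorr_row_split (hz : z ∈ gr N) (hq : 1 ≤ q) :
    ∑ B ∈ (Rq N (q - 1)).filter (fun B => z ∉ B ∧ z ∉ clF N B), lostCorr N z q B =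
      (q + 1) * ((Rq N (q - 1)).filter (fun B => z ∉ B ∧ (z ∉ clF N B ∧ z ∉ clF N ((gr N).erase z \ B)) ∧
          rk N ((gr N).erase z \ B) = q)).card +
        ((Rq N (q - 1)).filter (fun B => z ∉ B ∧ (z ∉ clF N B ∧ z ∉ clF N ((gr N).erase z \ B)) ∧
          q + 1 ≤ rk N ((gr N).erase z \ B))).card := by
  have hzz := hz
  rw [sum_filter, card_filter, card_filter, mul_sum, ← sum_add_distrib]
  refine sum_congr rfl (fun B _ => ?_)
  unfold lostCorr
  by_cases hzB : z ∉ B <;> by_cases h1 : z ∉ clF N B <;> by_cases h2 : z ∈ clF N ((gr N).erase z \ B) <;>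
    (simp only [hzB, h1, h2, not_true_eq_false, not_false_eq_true, true_and, false_and, and_true, and_false,
      if_true, if_false, mul_zero, add_zero, mul_one, mul_ite]; try (split_ifs <;> omega))

/-- **THE BI-COLOOP IDENTITY AT THE ROWS** (`t = q`, `2 ≤ q`): `thresholdSum (N∖z) + q·#T(N) + (thresholdSum' + #L')
+ #U + q·#V + #{bi-coloop (q−1, ≥ q+1)} = thresholdSum N + q·#T(N∖z) + q·#T' + Σ_{W₂}` — at the rows every bi-coloop
set of rank `q − 1` or `q` costs and only those of rank `q − 2` pay. -/
theorem biColoop_identity_row (hzI : N.Indep {z}) (hq : 2 ≤ q) :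
    thresholdSum (N ＼ ({z} : Set α)) q q + q * (levelSetCoQ N q q).card +
        (thresholdSum (N ／ ({z} : Set α)) (q - 1) (q - 1) +
          ((Rq (N ／ ({z} : Set α)) (q - 2)).filter
            (fun B' => q ≤ rk (N ／ ({z} : Set α)) (gr (N ／ ({z} : Set α)) \ B'))).card) +
        ((Rq N q).filter (fun S => z ∉ S ∧ (z ∉ clF N S ∧ z ∉ clF N ((gr N).erase z \ S)) ∧
          rk N ((gr N).erase z \ S) = q - 1)).card +
        q * ((Rq N (q - 1)).filter (fun S => z ∉ S ∧ (z ∉ clF N S ∧ z ∉ clF N ((gr N).erase z \ S)) ∧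
          rk N ((gr N).erase z \ S) = q - 1)).card +
        ((Rq N (q - 1)).filter (fun B => z ∉ B ∧ (z ∉ clF N B ∧ z ∉ clF N ((gr N).erase z \ B)) ∧
          q + 1 ≤ rk N ((gr N).erase z \ B))).card =
      thresholdSum N q q + q * (levelSetCoQ (N ＼ ({z} : Set α)) q q).card +
        q * (levelSetCoQ (N ／ ({z} : Set α)) (q - 1) (q - 1)).card +
        ∑ B' ∈ (Rq N (q - 2)).filter (fun B' => z ∉ B' ∧ z ∉ clF N B'), lostCorr N z q B' := by
  have hz : z ∈ gr N := mem_gr_of_indep hzI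
  have h := biColoop_identity (t := q) hzI hq (by omega)
  rw [sum_lostCorr_row_split hz (by omega), ← card_biColoop_row_compl hzI] at h
  set U := (Rq N q).filter (fun S => z ∉ S ∧ (z ∉ clF N S ∧ z ∉ clF N ((gr N).erase z \ S)) ∧
    rk N ((gr N).erase z \ S) = q - 1) with hU
  have hmul : (q + 1) * U.card = q * U.card + U.card := by ring
  omega

end BiColoopRow

end PercRepro.Cogirth
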